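import Summits.AnomalousDissipation.AnomalousDissipation.Theorems.MarginalStabilityChainBurgersLayerKHStubStrainedH

/-!
# Line `Sketch`, stub `stub_strained` (lead) — the stub

the registered stub `stub_strained` (StrainedPackage: existence of strained slow modes on the disc, continuity of
their sheet coefficient in `λ`, `ε`-closeness to the Rayleigh sheet coefficient for `h ≤ h₀(α, ε)`), assembled from parts A–H.
-/

set_option linter.dupNamespace false

noncomputable section

open Complex MeasureTheory Filter Topology Set Metric intervalIntegral

namespace Summit.AnomalousDissipation.AnomalousDissipation.Theorems.BurgersLayerKH.Sheet.Strained

/-- **The stub `stub_strained`: strained slow modes — existence, continuity in `λ`, `O(h)`-closeness of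
the sheet coefficient** (dissipative persistence of the Kelvin–Helmholtz mode under the strain and
viscous terms, `h = 1/(αRe) → 0`). [folklore] -/
theorem stub_strained : (∀ k : ℕ, 1 ≤ k → ∀ A : ℝ, VolterraPackage k A) → (∃ K : ℝ, ResolventBound K) → (∀ α : ℝ, 0 < α → α ≤ 1 → ∀ lam : ℂ, 0 < lam.re → ∀ h : ℝ, 0 < h → ResolventUniqueAt α h lam) → ∀ α : ℝ, 0 < α → α ≤ 1 → ∀ ε : ℝ, 0 < ε → StrainedPackage α ε := by
  intro hV hK hU α hα hα1 ε hε
  obtain ⟨K, hRes⟩ := hK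
  have hUpos := Uinf_pos
  set ℓ : ℝ := Uinf / 2 with hℓdef
  have hℓ : 0 < ℓ := by positivity
  have hVolt : VolterraPackage 1 (1 / ℓ) := hV 1 le_rfl (1 / ℓ)
  have hUq : ∀ lam : ℂ, 0 < lam.re → ∀ h : ℝ, 0 < h → ResolventUniqueAt α h lam := fun lam hlam h hh =>
    hU α hα hα1 lam hlam h hh
  have hdiscℓ : ∀ lam ∈ disc, ℓ ≤ lam.re := fun lam hlam => by
    have := re_ge_of_mem_disc hlam; rw [hℓdef]; linarith
  obtain ⟨h₁, hh₁, Cm, hCm0, hFP⟩ := exists_slowFixedPoint hα hα1 hℓ hVolt hRes hUq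
  obtain ⟨h₂, hh₂, L, hL0, hLip⟩ := lipschitz_apriori hα hα1 hℓ hVolt hRes hUq
  obtain ⟨h₃, hh₃, Lc, hLc0, hClose⟩ := close_apriori hα hα1 hℓ hVolt hRes hUq
  set h₀ : ℝ := min (min h₁ h₂) (min h₃ (2 * α * ε / (Lc + 1))) with hh₀
  have hh₀pos : 0 < h₀ := lt_min (lt_min hh₁ hh₂) (lt_min hh₃ (by positivity))
  refine ⟨h₀, hh₀pos, fun h hh hhle => ?_⟩
  have hhh₁ : h ≤ h₁ := hhle.trans ((min_le_left _ _).trans (min_le_left _ _))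
  have hhh₂ : h ≤ h₂ := hhle.trans ((min_le_left _ _).trans (min_le_right _ _))
  have hhh₃ : h ≤ h₃ := hhle.trans ((min_le_right _ _).trans (min_le_left _ _))
  have hhε : h ≤ 2 * α * ε / (Lc + 1) := hhle.trans ((min_le_right _ _).trans (min_le_right _ _))
  -- the family of fixed points
  have hex : ∀ lam : ℂ, ℓ ≤ lam.re → ∃ m Ω : ℝ → ℂ, Continuous m ∧ (∀ y, ‖m y‖ ≤ Cm * (1 + |y|)) ∧
      IsResolventSol α h lam (fun t => -(I * Upp t) * ((Real.exp (-(α * t)) : ℂ) * m t)) Ω ∧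
      GaussBound Ω (|K| * Real.exp 9 * Cm / ℓ) ∧
      ∀ y, m y = 1 - ∫ t in Ioi y, (volterraKernel α (t - y) : ℂ) * ((Real.exp (α * t) : ℂ) * Ω t) :=
    fun lam hlam => hFP h hh hhh₁ lam hlam
  choose! mOf ΩOf hspec using hex
  set Ψ : ℂ → ℝ → ℂ := fun lam y => (Real.exp (-(α * y)) : ℂ) * mOf lam y with hΨ
  have hmode : ∀ lam, ℓ ≤ lam.re → IsSlowMode α h lam (Ψ lam) ∧ vort α (Ψ lam) = ΩOf lam ∧
      sheetCoeff α (Ψ lam) = 1 - (1 / (2 * (α : ℂ))) * ∫ t : ℝ, (Real.exp (α * t) : ℂ) * ΩOf lam t := by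
    intro lam hlam
    obtain ⟨hmc, hmb, hΩ, hΩb, hrepr⟩ := hspec lam hlam
    exact slowMode_of_fixedPoint hα hmb hΩ hrepr
  have hα2 : ‖(1 / (2 * (α : ℂ)))‖ = 1 / (2 * α) := by
    rw [show (1 / (2 * (α : ℂ))) = ((1 / (2 * α) : ℝ) : ℂ) by push_cast; ring, Complex.norm_real,
      Real.norm_of_nonneg (by positivity)]
  refine ⟨Ψ, fun lam hlam => (hmode lam (hdiscℓ lam hlam)).1, ?_, ?_⟩
  · -- continuity in `λ` (Lipschitz on the disc)
    rw [Metric.continuousOn_iff]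
    intro lam₂ hlam₂ ε' hε'
    refine ⟨ε' / (1 / (2 * α) * (L * Cm) + 1), by positivity, fun lam₁ hlam₁ hdist => ?_⟩
    have hl₁ := hdiscℓ lam₁ hlam₁
    have hl₂ := hdiscℓ lam₂ hlam₂
    obtain ⟨hm₁c, hm₁b, hΩ₁, -, hr₁⟩ := hspec lam₁ hl₁
    obtain ⟨hm₂c, hm₂b, hΩ₂, -, hr₂⟩ := hspec lam₂ hl₂
    have hest := hLip h hh hhh₂ lam₁ lam₂ hl₁ hl₂ (mOf lam₁) (ΩOf lam₁) (mOf lam₂) (ΩOf lam₂) Cm hm₁c hm₂c hm₁b hm₂b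
      hΩ₁ hΩ₂ hr₁ hr₂
    rw [dist_eq_norm, (hmode lam₁ hl₁).2.2, (hmode lam₂ hl₂).2.2]
    rw [dist_eq_norm] at hdist
    have e : (1 - 1 / (2 * (α : ℂ)) * ∫ t : ℝ, (Real.exp (α * t) : ℂ) * ΩOf lam₁ t) -
        (1 - 1 / (2 * (α : ℂ)) * ∫ t : ℝ, (Real.exp (α * t) : ℂ) * ΩOf lam₂ t) =
        -(1 / (2 * (α : ℂ))) * ((∫ t : ℝ, (Real.exp (α * t) : ℂ) * ΩOf lam₁ t) - ∫ t : ℝ, (Real.exp (α * t) : ℂ) * ΩOf lam₂ t) := by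
      ring
    rw [e, norm_mul, norm_neg, hα2]
    have hpos : 0 < 1 / (2 * α) * (L * Cm) + 1 := by positivity
    calc 1 / (2 * α) * ‖(∫ t : ℝ, (Real.exp (α * t) : ℂ) * ΩOf lam₁ t) - ∫ t : ℝ, (Real.exp (α * t) : ℂ) * ΩOf lam₂ t‖
        ≤ 1 / (2 * α) * (L * Cm * ‖lam₁ - lam₂‖) := mul_le_mul_of_nonneg_left hest (by positivity)
      _ = (1 / (2 * α) * (L * Cm)) * ‖lam₁ - lam₂‖ := by ring
      _ ≤ (1 / (2 * α) * (L * Cm) + 1) * ‖lam₁ - lam₂‖ := by gcongr; linarith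
      _ < (1 / (2 * α) * (L * Cm) + 1) * (ε' / (1 / (2 * α) * (L * Cm) + 1)) := mul_lt_mul_of_pos_left hdist hpos
      _ = ε' := by field_simp
  · -- closeness to any `h = 0` slow mode
    intro lam hlam ψ₀ hψ₀
    have hl := hdiscℓ lam hlam
    obtain ⟨hmc, hmb, hΩ, -, hr⟩ := hspec lam hl
    have hest := hClose h hh hhh₃ lam hl (mOf lam) (ΩOf lam) Cm hmc hmb hΩ hr ψ₀ hψ₀
    rw [(hmode lam hl).2.2, sheetCoeff]
    have e : (1 - 1 / (2 * (α : ℂ)) * ∫ t : ℝ, (Real.exp (α * t) : ℂ) * ΩOf lam t) -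
        (1 - 1 / (2 * (α : ℂ)) * ∫ t : ℝ, (Real.exp (α * t) : ℂ) * vort α ψ₀ t) =
        -(1 / (2 * (α : ℂ))) * ((∫ t : ℝ, (Real.exp (α * t) : ℂ) * ΩOf lam t) - ∫ t : ℝ, (Real.exp (α * t) : ℂ) * vort α ψ₀ t) := by
      ring
    rw [e, norm_mul, norm_neg, hα2]
    calc 1 / (2 * α) * ‖(∫ t : ℝ, (Real.exp (α * t) : ℂ) * ΩOf lam t) - ∫ t : ℝ, (Real.exp (α * t) : ℂ) * vort α ψ₀ t‖
        ≤ 1 / (2 * α) * (Lc * h) := mul_le_mul_of_nonneg_left hest (by positivity)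
      _ ≤ 1 / (2 * α) * (Lc * (2 * α * ε / (Lc + 1))) := by gcongr
      _ = ε * (Lc / (Lc + 1)) := by field_simp
      _ ≤ ε * 1 := by gcongr; rw [div_le_one (by positivity)]; linarith
      _ = ε := mul_one ε

end Summit.AnomalousDissipation.AnomalousDissipation.Theorems.BurgersLayerKH.Sheet.Strained

end
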